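import Summits.CriticalPhenomena.PercolationContinuityZ3.Theorems.PercNearOneGluingNoHeavyQuantDominantWindowPieces
import Summits.CriticalPhenomena.PercolationContinuityZ3.Theorems.PercNearOneGluingNoHeavyQuantWindowMixDominant
import HarnessLib

/-!
# QUANT lane R8, T-DEC, leg (II): `LawDec.ConvClosedT` AT EVERY DOMINANT LAYER `2j < T₁ + T₂`, IN ITS OWN BINDER
# (windows of layers, explicit targets, no means, no top-affordability) — part 2 of 2

builds on p205010 (kernel theorem, internal audit signed; external expert review pending)

Support file (`--supports stmt-CriticalPhenomena-4575`), QUANT lane seat prim-quant-arm-2 (gen 34), rung R8 of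
`run/shared/lean/prim/quant/LADDER.md`.  Theorems only (no definitions), standard axioms, no sorries.  Part 1 `…QuantDominantWindowPieces`
(window forms `piece_ge_w`, `profile_minorant_w`; vacuity lemma `target_le_two_top_of_decAtT`); `…QuantWindowMixDominant` has the single-layer
two-layer bound `deepLows_le_giants_T`; `…QuantDominantPieces` the bookkeeping `assemble_dominant`.

WHAT.  `LawDec.ConvClosedT` (lead g22, `…QuantSliceConeForm`; leg (II)'s statement of record): `0 < x < 1`, probability laws `μ₁`, `μ₂` on
`{0..M₁}`, `{0..M₂}`, ANY real targets `T₁`, `T₂`, a layer `j`; `μ₁` DEC(i) at `T₁` for every `i ∈ [j − M₂, j]`, `μ₂` DEC(i) at `T₂` for every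
`i ∈ [j − M₁, j]` ⟹ `lconv μ₁ μ₂` DEC(j) at `T₁ + T₂`.  **`convClosedT_dominant`** proves it for every DOMINANT layer `2j < T₁ + T₂` (where
DEC(j) is the far row `x ≤ (μ₁∗μ₂){> j}`, `decAtT_of_giantMass_ge`), with exactly these window hypotheses (`j < M₁ + M₂` not needed).
`…QuantDominantClosure` proved the same under DEC at EVERY layer with the laws' means as targets; the proof here is the same extreme-profile
argument run on window data: factor 1's bounds are read at the layers `j − s`, `s ≤ M₂` (`profile_minorant_w`) and at its last dominant layer
`⌈T₁/2⌉ − 1`; factor 2's at the layers `j − k`, `k ≤ M₁` (`piece_ge_w`) and `j − ⌈T₁/2⌉`.  The two layers that may fall outside the windows do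
so only in DEGENERATE regimes, which are vacuous by `target_le_two_top_of_decAtT` (a law DEC at a layer `≥` its top has target `≤ 2·top`):
`⌈T₁/2⌉ > M₁` would put the window layer `j ≥ M₁` of factor 1 above its top with `T₁ > 2M₁`; `⌈T₁/2⌉ − 1 < j − M₂` would put the window
layer `j ≥ M₂` of factor 2 above its top with `T₂ > 2j − T₁ ≥ 2M₂`.

* **`LawDec.lconv_tail_ge_dominant_window`** — the far row `x ≤ Σ_{j < h ≤ M₁+M₂} lconv μ₁ μ₂ h` from the window hypotheses, `2j < T₁ + T₂`.
* **`LawDec.convClosedT_dominant`** — `DECAtT x (T₁ + T₂) j (M₁ + M₂) (lconv M₁ M₂ μ₁ μ₂)` for every `2j < T₁ + T₂` (ConvClosedT's binder).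
HONEST STATUS: `ConvClosedT` at the NON-dominant layers `2j ≥ T₁ + T₂` (genuine decompositions; the (II) cells of census-1/2) remains OPEN, as do
`SingleGateConvClosed`, CW, `GateMove`, `TreeDEC`, `FarTreeRow`; the RATE class log\* and the honest sentence of
`run/shared/lean/prim/quant/README.md` are unchanged.

[this work]; `ConvClosedT`: prim-quant-lead g22 (this lane).  Nothing here is cited as a published result.  The gluing rows served
[cite: KozmaNitzan2024, Conjecture 3 (p. 15)]; product measure [cite: Grimmett1999, §1.3 p. 10].
-/

noncomputable section

namespace Summit.CriticalPhenomena.PercolationContinuityZ3.Theorems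

namespace Quant

open Finset

/-- the mass of `μ` (a law on `{0..M}`) strictly above the layer `a` -/
local notation3 "TAIL[" μ ", " M ", " a "]" =>
  ∑ h ∈ Finset.range ((M : ℕ) + 1), (if (a : ℕ) + 1 ≤ h then (μ : ℕ → ℝ) h else 0)

/-- the mass of `μ` (a law on `{0..M}`) at or below the layer `a` -/
local notation3 "LOW[" μ ", " M ", " a "]" =>
  ∑ h ∈ Finset.range ((M : ℕ) + 1), (if h ≤ (a : ℕ) then (μ : ℕ → ℝ) h else 0)

namespace LawDec

/-- **THE FAR ROW OF THE CONVOLUTION AT A DOMINANT LAYER, FROM WINDOW DATA.**  `0 < x < 1`; `μ₁`, `μ₂` probability laws on `{0..M₁}`,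
`{0..M₂}`; any real targets `t₁`, `t₂`; `μ₁` is `DECAtT x t₁ i M₁ μ₁` for every `i ≤ j` with `j ≤ i + M₂`, `μ₂` is `DECAtT x t₂ i M₂ μ₂` for
every `i ≤ j` with `j ≤ i + M₁`; `2j < t₁ + t₂`.  Then `x ≤ Σ_{j < h ≤ M₁+M₂} lconv μ₁ μ₂ h`. [this work] -/
theorem lconv_tail_ge_dominant_window (x t₁ t₂ : ℝ) (j M₁ M₂ : ℕ) (μ₁ μ₂ : ℕ → ℝ) (hx0 : 0 < x) (hx1 : x < 1)
    (h10 : ∀ h, 0 ≤ μ₁ h) (h11 : ∑ h ∈ Finset.range (M₁ + 1), μ₁ h = 1)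
    (h20 : ∀ h, 0 ≤ μ₂ h) (h21 : ∑ h ∈ Finset.range (M₂ + 1), μ₂ h = 1)
    (hW1 : ∀ i, i ≤ j → j ≤ i + M₂ → DECAtT x t₁ i M₁ μ₁)
    (hW2 : ∀ i, i ≤ j → j ≤ i + M₁ → DECAtT x t₂ i M₂ μ₂) (hdom : 2 * (j : ℝ) < t₁ + t₂) :
    x ≤ ∑ h ∈ Finset.Ico (j + 1) (M₁ + M₂ + 1), lconv M₁ M₂ μ₁ μ₂ h := by
  classical
  have h1x : 0 < 1 - x := by linarith
  -- two-layer bounds and rows from the windows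
  have hDL1 : ∀ i i' : ℕ, i' ≤ i → i ≤ j → j ≤ i + M₂ → (i : ℝ) + i' < t₁ →
      x * LOW[μ₁, M₁, i'] ≤ (1 - x) * TAIL[μ₁, M₁, i] :=
    fun i i' hii hij hji hlt => deepLows_le_giants_T x t₁ M₁ i i' μ₁ hx0 hx1 (hW1 i hij hji) hii hlt
  have hDL2 : ∀ i i' : ℕ, i' ≤ i → i ≤ j → j ≤ i + M₁ → (i : ℝ) + i' < t₂ →
      x * LOW[μ₂, M₂, i'] ≤ (1 - x) * TAIL[μ₂, M₂, i] :=
    fun i i' hii hij hji hlt => deepLows_le_giants_T x t₂ M₂ i i' μ₂ hx0 hx1 (hW2 i hij hji) hii hlt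
  have hLT1 : ∀ b : ℕ, LOW[μ₁, M₁, b] + TAIL[μ₁, M₁, b] = 1 := fun b => by rw [sum_le_add_sum_gt, h11]
  have hLT2 : ∀ b : ℕ, LOW[μ₂, M₂, b] + TAIL[μ₂, M₂, b] = 1 := fun b => by rw [sum_le_add_sum_gt, h21]
  have hrow1 : ∀ i : ℕ, i ≤ j → j ≤ i + M₂ → 2 * (i : ℝ) < t₁ → x ≤ TAIL[μ₁, M₁, i] := fun i h1 h2 h3 => by
    have := hDL1 i i le_rfl h1 h2 (by linarith)
    have := hLT1 i
    nlinarith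
  have hrow2 : ∀ i : ℕ, i ≤ j → j ≤ i + M₁ → 2 * (i : ℝ) < t₂ → x ≤ TAIL[μ₂, M₂, i] := fun i h1 h2 h3 => by
    have := hDL2 i i le_rfl h1 h2 (by linarith)
    have := hLT2 i
    nlinarith
  -- the tail of the convolution, column by column
  have hS : ∑ h ∈ Finset.Ico (j + 1) (M₁ + M₂ + 1), lconv M₁ M₂ μ₁ μ₂ h
      = ∑ s ∈ Finset.range (M₂ + 1), μ₂ s * ∑ i ∈ Finset.range (M₁ + 1), (if j + 1 ≤ i + s then μ₁ i else 0) := by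
    rw [conv_tail_eq, Finset.sum_comm]
    refine Finset.sum_congr rfl fun s _ => ?_
    rw [Finset.mul_sum]
    refine Finset.sum_congr rfl fun i _ => ?_
    split_ifs <;> ring
  rw [hS]
  have hA1 : ∀ s, j + 1 ≤ s → ∑ i ∈ Finset.range (M₁ + 1), (if j + 1 ≤ i + s then μ₁ i else 0) = 1 := fun s hs => by
    rw [← h11]
    exact Finset.sum_congr rfl fun i _ => if_pos (by omega)
  have hA0 : ∀ s, 0 ≤ ∑ i ∈ Finset.range (M₁ + 1), (if j + 1 ≤ i + s then μ₁ i else 0) := fun s =>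
    Finset.sum_nonneg fun i _ => by split_ifs; exacts [h10 i, le_rfl]
  have hAmono : ∀ s, TAIL[μ₁, M₁, j] ≤ ∑ i ∈ Finset.range (M₁ + 1), (if j + 1 ≤ i + s then μ₁ i else 0) := fun s =>
    Finset.sum_le_sum fun i _ => by
      by_cases hi : j + 1 ≤ i
      · rw [if_pos hi, if_pos (by omega)]
      · rw [if_neg hi]; split_ifs; exacts [h10 i, le_rfl]
  by_cases hcase : x ≤ TAIL[μ₂, M₂, j]
  · -- the columns above `j` alone carry `μ₂{> j} ≥ x`
    calc x ≤ TAIL[μ₂, M₂, j] := hcase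
      _ = ∑ s ∈ Finset.range (M₂ + 1), (if j + 1 ≤ s then μ₂ s * 1 else 0) :=
          Finset.sum_congr rfl fun s _ => by split_ifs <;> ring
      _ ≤ _ := Finset.sum_le_sum fun s _ => by
          by_cases hs : j + 1 ≤ s
          · rw [if_pos hs, hA1 s hs]
          · rw [if_neg hs]; exact mul_nonneg (h20 s) (hA0 s)
  · have hcase' : 1 * TAIL[μ₂, M₂, j] ≤ x := by rw [one_mul]; exact (not_le.1 hcase).le
    by_cases hdomj : 2 * (j : ℝ) < t₁
    · -- `j` is dominant for `μ₁`: every column carries `μ₁{> j} ≥ x`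
      calc x ≤ TAIL[μ₁, M₁, j] := hrow1 j le_rfl (by omega) hdomj
        _ = ∑ s ∈ Finset.range (M₂ + 1), μ₂ s * TAIL[μ₁, M₁, j] := by rw [← Finset.sum_mul, h21, one_mul]
        _ ≤ _ := Finset.sum_le_sum fun s _ => mul_le_mul_of_nonneg_left (hAmono s) (h20 s)
    · have hdomj' : t₁ ≤ 2 * (j : ℝ) := not_lt.1 hdomj
      -- degenerate regime 1 is vacuous: `t₁ ≤ 2M₁`
      have ht1M : t₁ ≤ 2 * (M₁ : ℝ) := by
        by_contra hc
        have hjM : M₁ ≤ j := by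
          have : (M₁ : ℝ) < j + 1 := by linarith [not_le.1 hc]
          have : M₁ < j + 1 := by exact_mod_cast this
          omega
        exact hc (target_le_two_top_of_decAtT x t₁ j M₁ μ₁ hx0 hx1 hjM (hW1 j le_rfl (by omega)))
      set m : ℕ := ⌈t₁ / 2⌉₊ with hm
      have hmM : m ≤ M₁ := Nat.ceil_le.2 (by linarith)
      have hmj : m ≤ j := Nat.ceil_le.2 (by linarith)
      have hmt : t₁ / 2 ≤ m := Nat.le_ceil _
      -- the weight of the top profile is nonnegative (row at the last dominant layer; degenerate regime 2 is vacuous)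
      have hR0 : 0 ≤ (∑ k ∈ Finset.range (M₁ + 1), (if 2 * (k : ℝ) < t₁ then 0 else μ₁ k)) - x := by
        by_cases ht : t₁ ≤ 0
        · rw [Finset.sum_congr rfl fun k _ => if_neg (by linarith [(Nat.cast_nonneg k : (0 : ℝ) ≤ k)]), h11]
          linarith
        · have ht' : 0 < t₁ := not_le.1 ht
          have hm0 : 0 < m := Nat.ceil_pos.2 (by linarith)
          have hm1 : (((m - 1 : ℕ) : ℝ)) < t₁ / 2 := by
            have : m - 1 < m := by omega
            rw [hm] at this
            exact (Nat.lt_ceil).1 this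
          have hz : ∑ k ∈ Finset.range (M₁ + 1), (if 2 * (k : ℝ) < t₁ then 0 else μ₁ k) = TAIL[μ₁, M₁, m - 1] :=
            Finset.sum_congr rfl fun k _ => by
              have e : (2 * (k : ℝ) < t₁) ↔ ¬ (m - 1 + 1 ≤ k) := by
                rw [show (2 * (k : ℝ) < t₁) ↔ ((k : ℝ) < t₁ / 2) from ⟨fun h => by linarith, fun h => by linarith⟩,
                  ← Nat.lt_ceil, ← hm]
                omega
              simp only [e, ite_not]
          rw [hz]
          by_cases hwin : j ≤ m - 1 + M₂
          · have := hrow1 (m - 1) (by omega) hwin (by linarith)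
            linarith
          · exfalso
            have hjM2 : M₂ ≤ j := by omega
            have ht2 := target_le_two_top_of_decAtT x t₂ j M₂ μ₂ hx0 hx1 hjM2 (hW2 j le_rfl (by omega))
            have e1 : (((j - M₂ : ℕ) : ℝ)) < t₁ / 2 := by
              push_cast [Nat.cast_sub hjM2]
              linarith
            have e2 : j - M₂ < m := by rw [hm]; exact (Nat.lt_ceil).2 e1
            omega
      -- the top profile's columns: `μ₂{> j − m} ≥ x`
      have hW' : x ≤ ∑ s ∈ Finset.range (M₂ + 1), μ₂ s * (if j + 1 ≤ s then (1 : ℝ) else (if (j : ℝ) < s + t₁ / 2 then 1 else 0)) := by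
        have e : ∑ s ∈ Finset.range (M₂ + 1), μ₂ s * (if j + 1 ≤ s then (1 : ℝ) else (if (j : ℝ) < s + t₁ / 2 then 1 else 0))
            = TAIL[μ₂, M₂, j - m] :=
          Finset.sum_congr rfl fun s _ => by
            by_cases hs : j + 1 ≤ s
            · rw [if_pos hs, if_pos (by omega), mul_one]
            · rw [if_neg hs]
              by_cases h2 : (j : ℝ) < s + t₁ / 2
              · have h3 : (j : ℝ) < s + m := by linarith
                have h4 : j < s + m := by exact_mod_cast h3
                rw [if_pos h2, mul_one, if_pos (by omega)]
              · have h3 : (s : ℝ) + t₁ / 2 ≤ j := not_lt.1 h2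
                have h4 : s + m ≤ j := by
                  rcases Nat.eq_zero_or_pos m with hm0 | hm0
                  · rw [hm0]; omega
                  · have hm1 : (((m - 1 : ℕ) : ℝ)) < t₁ / 2 := by
                      have : m - 1 < m := by omega
                      rw [hm] at this
                      exact (Nat.lt_ceil).1 this
                    have : ((s : ℝ)) + ((m - 1 : ℕ) : ℝ) < j := by linarith
                    have : s + (m - 1) < j := by exact_mod_cast this
                    omega
                rw [if_neg h2, mul_zero, if_neg (by omega)]
        rw [e]
        exact hrow2 (j - m) (Nat.sub_le j m) (by omega) (by
          have : (((j - m : ℕ) : ℝ)) = (j : ℝ) - m := by push_cast [Nat.cast_sub hmj]; ring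
          rw [this]; linarith)
      -- assembly
      have hLR : ∑ k ∈ Finset.range (M₁ + 1), (if 2 * (k : ℝ) < t₁ then μ₁ k else 0)
          + ((∑ k ∈ Finset.range (M₁ + 1), (if 2 * (k : ℝ) < t₁ then 0 else μ₁ k)) - x) = 1 - x := by
        have : ∑ k ∈ Finset.range (M₁ + 1), (if 2 * (k : ℝ) < t₁ then μ₁ k else 0)
            + ∑ k ∈ Finset.range (M₁ + 1), (if 2 * (k : ℝ) < t₁ then 0 else μ₁ k) = 1 := by
          rw [← Finset.sum_add_distrib, ← h11]
          exact Finset.sum_congr rfl fun k _ => by split_ifs <;> ring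
        linarith
      have hc0 : ∀ k : ℕ, 0 ≤ (if 2 * (k : ℝ) < t₁ then μ₁ k else 0) := fun k => by
        split_ifs; exacts [h10 k, le_rfl]
      have hdl2' : ∀ a i' : ℕ, i' ≤ a → a ≤ j → j ≤ a + M₁ → (a : ℝ) + i' < t₂ →
          x * (1 - 1 * TAIL[μ₂, M₂, i']) ≤ (1 - x) * (1 * TAIL[μ₂, M₂, a]) := by
        intro a i' h1 h2 h3 h4
        rw [one_mul, one_mul, show 1 - TAIL[μ₂, M₂, i'] = LOW[μ₂, M₂, i'] by linarith [hLT2 i']]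
        exact hDL2 a i' h1 h2 h3 h4
      refine assemble_dominant x ((∑ k ∈ Finset.range (M₁ + 1), (if 2 * (k : ℝ) < t₁ then 0 else μ₁ k)) - x) M₁ M₂ μ₂
        (fun k => if 2 * (k : ℝ) < t₁ then μ₁ k else 0)
        (fun s => if j + 1 ≤ s then (1 : ℝ) else (if (j : ℝ) < s + t₁ / 2 then 1 else 0))
        (fun s => ∑ i ∈ Finset.range (M₁ + 1), (if j + 1 ≤ i + s then μ₁ i else 0))
        (fun k s => if j + 1 ≤ s then (1 : ℝ) else
          ((if (j : ℝ) < s + k then (1 : ℝ) else 0) + x * (if (s : ℝ) + k ≤ j ∧ (j : ℝ) + k < t₁ + s then (1 : ℝ) else 0)))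
        hx1 h20 hc0 hR0 hLR ?_ ?_ hW'
      · -- the pointwise minorant, column by column (factor 1's data at the layer `j − s`)
        intro s hs'
        have hsM : s ≤ M₂ := Nat.lt_succ_iff.1 (Finset.mem_range.1 hs')
        by_cases hs : j + 1 ≤ s
        · simp only [if_pos hs, mul_one]
          rw [hA1 s hs, mul_one, hLR]
        · have hsj : s ≤ j := by omega
          simp only [if_neg hs]
          refine profile_minorant_w x t₁ j s M₁ μ₁ hx1.le h10 h11 (fun i' h1 h2 => ?_) hsj
          have h := hDL1 (j - s) i' (by omega) (Nat.sub_le j s) (by omega) (by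
            have : (((j - s : ℕ) : ℝ)) = (j : ℝ) - s := by push_cast [Nat.cast_sub hsj]; ring
            rw [this]; linarith)
          have e : TAIL[μ₁, M₁, j - s] = ∑ h ∈ Finset.range (M₁ + 1), (if j + 1 ≤ h + s then μ₁ h else 0) :=
            Finset.sum_congr rfl fun h _ => by
              by_cases hh : j - s + 1 ≤ h
              · rw [if_pos hh, if_pos (by omega)]
              · rw [if_neg hh, if_neg (by omega)]
          rwa [e] at h
      · -- against each extreme profile the columns carry `x` (factor 2's data at the layers `j − k`, `k ≤ M₁`)
        intro k hk
        have hkM : (k : ℝ) ≤ M₁ := by exact_mod_cast Nat.lt_succ_iff.1 (Finset.mem_range.1 hk)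
        exact piece_ge_w x 1 t₁ t₂ (k : ℝ) j M₂ M₁ μ₂ hx0 hx1.le le_rfl h20 h21 hdl2' (Nat.cast_nonneg k) hkM hdom hcase'

/-- **`ConvClosedT` AT EVERY DOMINANT LAYER, in its own binder.**  `0 < x < 1`; `μ₁ ≥ 0` on `{0..M₁}` and `μ₂ ≥ 0` on `{0..M₂}` probability
laws; ANY real targets `T₁`, `T₂`; `μ₁` is `DECAtT x T₁ j″ M₁ μ₁` for every `j″ ≤ j` with `j ≤ j″ + M₂` and `μ₂` is `DECAtT x T₂ j″ M₂ μ₂` for every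
`j″ ≤ j` with `j ≤ j″ + M₁`; `2j < T₁ + T₂`.  Then `lconv M₁ M₂ μ₁ μ₂` is `DECAtT x (T₁ + T₂) j (M₁ + M₂)` — the conclusion of
`LawDec.ConvClosedT` at the layer `j` (`j < M₁ + M₂` not needed). [this work] -/
theorem convClosedT_dominant (x T₁ T₂ : ℝ) (M₁ M₂ j : ℕ) (μ₁ μ₂ : ℕ → ℝ) (hx0 : 0 < x) (hx1 : x < 1)
    (h10 : ∀ h, 0 ≤ μ₁ h) (h11 : ∑ h ∈ Finset.range (M₁ + 1), μ₁ h = 1)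
    (h20 : ∀ h, 0 ≤ μ₂ h) (h21 : ∑ h ∈ Finset.range (M₂ + 1), μ₂ h = 1)
    (hW1 : ∀ j'', j'' ≤ j → j ≤ j'' + M₂ → DECAtT x T₁ j'' M₁ μ₁)
    (hW2 : ∀ j'', j'' ≤ j → j ≤ j'' + M₁ → DECAtT x T₂ j'' M₂ μ₂) (hdom : 2 * (j : ℝ) < T₁ + T₂) :
    DECAtT x (T₁ + T₂) j (M₁ + M₂) (lconv M₁ M₂ μ₁ μ₂) :=
  decAtT_of_giantMass_ge x (T₁ + T₂) j (M₁ + M₂) (lconv M₁ M₂ μ₁ μ₂) hx0 hx1 (lconv_nonneg M₁ M₂ μ₁ μ₂ h10 h20)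
    (fun h hh => lconv_eq_zero M₁ M₂ μ₁ μ₂ h hh) (sum_lconv M₁ M₂ μ₁ μ₂ h11 h21)
    (lconv_tail_ge_dominant_window x T₁ T₂ j M₁ M₂ μ₁ μ₂ hx0 hx1 h10 h11 h20 h21 hW1 hW2 hdom)

end LawDec

end Quant

end Summit.CriticalPhenomena.PercolationContinuityZ3.Theorems
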